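/-
Copyright (c) 2026 the pub-hodgecm-mathlib formalisation cell (harness21).  Prover seat hodgecm-mathlib-B-p10 (g27), 2026-09-01.  Road «W′» = «R1LL-WILD»
((W′-B6) sub-socket (B6-V), brick (V-deep)): the descent ∕ congruence ∕ depth kit for «DEEP SHELL AVERAGES AGREE».
-/
import Literature.NumberTheory.Automorphic.UnitaryTwoDescentConjugateNormalForm   -- ★ p844158 B-p14 (g33): `descent_inv_eq_inv_smul_map_inv` (+ ★ `diagonal_inv_mul_diagonal`, `toPlace`, `exists_exp_lt_of_mem_nhds`)
import Literature.NumberTheory.LocalFields.QuadraticOrderDeepShells               -- ★ p844005 A-p12 (g19) (Ψ2): `diagonal_inv_mul_mul_diagonal_apply`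
import HarnessLib

/-!
# Descent of a quotient, `ϖ^j`-congruence of `2 × 2` quotients, and quantitative neighbourhoods of `1` in subgroups of `GL₂(L_w)`
# (the kit under (V-deep) «deep shell averages agree»; Labesse–Langlands 1979 §2 (2.2))

Topic `NumberTheory/Automorphic`; namespace `Literature.NumberTheory.Automorphic.UnitaryGroup` (continues ★ B-p14 (g33) `UnitaryTwoDescentConjugateNormalForm`'s
descent currency `diag(1,α)·X·diag(1,α)⁻¹ = ζ • ι(S)`).  THEOREMS ONLY (no definition, no named fact, no instance, no notation, no `sorry`; net debt 0).
Cell `pub/hodgecm-mathlib`, F0∕P3a, crux H413 = `stmt-HodgeConjecture-24833`, road «W′» = «R1LL-WILD» (architect A-p16 (g28)), (B6-V) owner B-p14 (g33), brick (V-deep)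
(seat B-p10 (g27)).  HONEST LABEL: HC_CM is proved only modulo the printed citations (2 remaining named inputs hLiu418, h413) until rung 0 closes; nothing printed is
asserted here — elementary matrix algebra, ultrametric estimates and point-set topology.

* §2 DESCENT OF A QUOTIENT: `eq_diagonal_inv_mul_mul_diagonal_of_descent` (un-conjugating), `descent_scalar_ne_zero`, **`descent_inv_mul_eq_map`** — if `d X d⁻¹ = ζ·ι(S)` and
  `d X′ d⁻¹ = ζ·ι(S′)` with the SAME scalar then `d (X⁻¹X′) d⁻¹ = ι(S⁻¹S′)`.
* §3 ESTIMATES (any valued field): `forall_v_le_one_of_forall_v_sub_one_le`, `v_det_eq_one_of_forall_v_sub_one_le`, **`forall_v_inv_mul_sub_one_le`** (`S ≡ 1 ≡ S′ (mod ≤ r)`,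
  `r < 1` ⇒ `S⁻¹S′ ≡ 1 (mod ≤ r)`), **`forall_v_diagonal_twist_sub_one_le`** (the `diag(1,α)`-twist costs `|α|⁻¹`).
* §4 DEPTH (at a place `w`): `exists_forall_matrix_mem_of_mem_nhds_one` (entrywise `exp(−j)`-balls shrink into every neighbourhood of `1 ∈ M₂(L_w)`),
  **`exists_depth_mem_of_mem_nhds_one`** (same for `1 ∈ Γ ≤ GL₂(L_w)` in the units topology, reading `g` and `g⁻¹`).

## References
* [LabesseLanglands1979] J.-P. Labesse, R. P. Langlands, *L-indistinguishability for SL(2)*, Canad. J. Math. 31 (1979) 726–785: §2 (2.1)–(2.2), pp. 8–9.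
* [Serre1980Trees] J.-P. Serre, *Trees* (1980), Ch. II §1.2–§1.3.
* [NeukirchANT1999] J. Neukirch, *Algebraic Number Theory* (1999), Ch. II §5 (5.3) (the higher unit groups are a neighbourhood basis).
-/

set_option autoImplicit false

noncomputable section

open scoped Matrix ValuativeRel MatrixGroups Topology WithZero
open Matrix ValuativeRel NumberField IsDedekindDomain Filter Set

namespace Literature.NumberTheory.Automorphic.UnitaryGroup

open Literature.NumberTheory.Automorphic

/-! ## §2 Descent algebra: the quotient `X⁻¹ X′` of two elements with the same descent scalar -/

section DescentAlgebra

variable {F : Type*} [Field F] {E : Type*} [Field E] (ι : F →+* E) {α : E}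

omit [Field F] in
/-- Un-conjugating: `d Y d⁻¹ = M` gives `Y = d⁻¹ M d` (`d = diag(1, α)`). [cite: Serre1980Trees, Ch. II §1.2–1.3] -/
theorem eq_diagonal_inv_mul_mul_diagonal_of_descent (hα0 : α ≠ 0) {Y M : Matrix (Fin 2) (Fin 2) E}
    (h : Matrix.diagonal ![1, α] * Y * Matrix.diagonal ![1, α⁻¹] = M) :
    Y = Matrix.diagonal ![1, α⁻¹] * M * Matrix.diagonal ![1, α] := by
  rw [← h]
  simp only [Matrix.mul_assoc]
  rw [diagonal_inv_mul_diagonal hα0, Matrix.mul_one, ← Matrix.mul_assoc, diagonal_inv_mul_diagonal hα0, Matrix.one_mul]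

/-- The descent scalar of an invertible matrix is non-zero. [cite: Serre1980Trees, Ch. II §1.2–1.3] -/
theorem descent_scalar_ne_zero (hα0 : α ≠ 0) {X : GL (Fin 2) E} {ζ : E} {S : GL (Fin 2) F}
    (hX : Matrix.diagonal ![1, α] * (X : Matrix (Fin 2) (Fin 2) E) * Matrix.diagonal ![1, α⁻¹] = ζ • (S : Matrix (Fin 2) (Fin 2) F).map ι) :
    ζ ≠ 0 := by
  intro hζ
  rw [hζ, zero_smul] at hX
  have hXz : (X : Matrix (Fin 2) (Fin 2) E) = 0 := by
    rw [eq_diagonal_inv_mul_mul_diagonal_of_descent hα0 hX, Matrix.mul_zero, Matrix.zero_mul]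
  have hdet : IsUnit (X : Matrix (Fin 2) (Fin 2) E).det := (Matrix.isUnit_iff_isUnit_det _).1 (Units.isUnit X)
  rw [hXz, Matrix.det_zero] at hdet
  exact not_isUnit_zero hdet

/-- **DESCENT OF THE QUOTIENT**: if `d X d⁻¹ = ζ · ι(S)` and `d X′ d⁻¹ = ζ · ι(S′)` (SAME scalar `ζ`), then `d (X⁻¹ X′) d⁻¹ = ι(S⁻¹ S′)` — the scalar cancels
(★ `descent_inv_eq_inv_smul_map_inv`). [cite: Serre1980Trees, Ch. II §1.2–1.3] [cite: LabesseLanglands1979, §2 p. 8] -/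
theorem descent_inv_mul_eq_map (hα0 : α ≠ 0) {X X' : GL (Fin 2) E} {ζ : E} {S S' : GL (Fin 2) F}
    (hX : Matrix.diagonal ![1, α] * (X : Matrix (Fin 2) (Fin 2) E) * Matrix.diagonal ![1, α⁻¹] = ζ • (S : Matrix (Fin 2) (Fin 2) F).map ι)
    (hX' : Matrix.diagonal ![1, α] * (X' : Matrix (Fin 2) (Fin 2) E) * Matrix.diagonal ![1, α⁻¹] = ζ • (S' : Matrix (Fin 2) (Fin 2) F).map ι) :
    Matrix.diagonal ![1, α] * ((X⁻¹ * X' : GL (Fin 2) E) : Matrix (Fin 2) (Fin 2) E) * Matrix.diagonal ![1, α⁻¹] =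
      ((S⁻¹ * S' : GL (Fin 2) F) : Matrix (Fin 2) (Fin 2) F).map ι := by
  have hζ : ζ ≠ 0 := descent_scalar_ne_zero ι hα0 hX
  have hsplit : Matrix.diagonal ![1, α] * ((X⁻¹ * X' : GL (Fin 2) E) : Matrix (Fin 2) (Fin 2) E) * Matrix.diagonal ![1, α⁻¹] =
      (Matrix.diagonal ![1, α] * ((X⁻¹ : GL (Fin 2) E) : Matrix (Fin 2) (Fin 2) E) * Matrix.diagonal ![1, α⁻¹]) *
        (Matrix.diagonal ![1, α] * (X' : Matrix (Fin 2) (Fin 2) E) * Matrix.diagonal ![1, α⁻¹]) := by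
    rw [Units.val_mul]
    simp only [Matrix.mul_assoc]
    rw [← Matrix.mul_assoc (Matrix.diagonal ![1, α⁻¹]) (Matrix.diagonal ![1, α]), diagonal_inv_mul_diagonal hα0, Matrix.one_mul]
  rw [hsplit, descent_inv_eq_inv_smul_map_inv ι hα0 hζ hX, hX', Matrix.smul_mul, Matrix.mul_smul, smul_smul, inv_mul_cancel₀ hζ, one_smul,
    ← Matrix.map_mul, Units.val_mul]

end DescentAlgebra

/-! ## §3 Valuation estimates on `2 × 2` matrices: quotients of `ϖ^j`-congruent-to-`1` matrices, the `diag(1,α)`-twist -/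

section Estimates

variable {K : Type*} [Field K] {Γ₀ : Type*} [LinearOrderedCommGroupWithZero Γ₀] [hK : Valued K Γ₀]

/-- Entries of a matrix `r`-close to `1` (`r ≤ 1`) are integral. [cite: LabesseLanglands1979, §2 p. 8] -/
theorem forall_v_le_one_of_forall_v_sub_one_le {A : Matrix (Fin 2) (Fin 2) K} {r : Γ₀} (hr : r ≤ 1)
    (hA : ∀ i k, Valued.v ((A - 1) i k) ≤ r) : ∀ i k, Valued.v (A i k) ≤ 1 := by
  intro i k
  have hsplit : A i k = (A - 1) i k + (1 : Matrix (Fin 2) (Fin 2) K) i k := by simp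
  rw [hsplit]
  refine (Valuation.map_add_le_max' _ _ _).trans (max_le ((hA i k).trans hr) ?_)
  rcases eq_or_ne i k with h | h
  · subst h; simp
  · simp [Matrix.one_apply_ne h]

/-- The determinant of a matrix `r`-close to `1` (`r < 1`) has valuation `1`. [cite: LabesseLanglands1979, §2 p. 8] -/
theorem v_det_eq_one_of_forall_v_sub_one_le {A : Matrix (Fin 2) (Fin 2) K} {r : Γ₀} (hr : r < 1)
    (hA : ∀ i k, Valued.v ((A - 1) i k) ≤ r) : Valued.v A.det = 1 := by
  have hint := forall_v_le_one_of_forall_v_sub_one_le hr.le hA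
  have h00 : Valued.v (A 0 0 - 1) ≤ r := by simpa using hA 0 0
  have h11 : Valued.v (A 1 1 - 1) ≤ r := by simpa using hA 1 1
  have h01 : Valued.v (A 0 1) ≤ r := by simpa using hA 0 1
  have h10 : Valued.v (A 1 0) ≤ r := by simpa using hA 1 0
  have hdet : A.det = 1 + ((A 0 0 - 1) * A 1 1 + (A 1 1 - 1) - A 0 1 * A 1 0) := by
    rw [Matrix.det_fin_two]; ring
  rw [hdet]
  refine Valued.v.map_one_add_of_lt ?_
  refine lt_of_le_of_lt (b := r) ?_ hr
  refine Valued.v.map_sub_le ?_ ?_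
  · refine Valued.v.map_add_le ?_ h11
    rw [map_mul]
    exact (mul_le_mul' h00 (hint 1 1)).trans_eq (mul_one r)
  · rw [map_mul]
    exact (mul_le_mul' h01 h10).trans ((mul_le_mul_left hr.le r).trans_eq (one_mul r))

/-- **QUOTIENTS OF `r`-CONGRUENT MATRICES ARE `r`-CONGRUENT** (`r < 1`): if `S ≡ 1 ≡ S′` entrywise modulo valuation `≤ r` then `S⁻¹ S′ ≡ 1` likewise
(`S⁻¹ = det⁻¹ · adj S` is integral, `S⁻¹S′ − 1 = S⁻¹ (S′ − S)`). [cite: LabesseLanglands1979, §2 (2.2) p. 9] -/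
theorem forall_v_inv_mul_sub_one_le {S S' : GL (Fin 2) K} {r : Γ₀} (hr : r < 1)
    (hS : ∀ i k, Valued.v (((S : Matrix (Fin 2) (Fin 2) K) - 1) i k) ≤ r) (hS' : ∀ i k, Valued.v (((S' : Matrix (Fin 2) (Fin 2) K) - 1) i k) ≤ r) :
    ∀ i k, Valued.v ((((S⁻¹ * S' : GL (Fin 2) K) : Matrix (Fin 2) (Fin 2) K) - 1) i k) ≤ r := by
  have hint := forall_v_le_one_of_forall_v_sub_one_le hr.le hS
  have hdet : Valued.v (S : Matrix (Fin 2) (Fin 2) K).det = 1 := v_det_eq_one_of_forall_v_sub_one_le hr hS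
  have hdet0 : (S : Matrix (Fin 2) (Fin 2) K).det ≠ 0 := fun h => by rw [h, map_zero] at hdet; exact zero_ne_one hdet
  -- the inverse is `det⁻¹ • adj`, with integral entries
  have hinv : ((S⁻¹ : GL (Fin 2) K) : Matrix (Fin 2) (Fin 2) K) = (S : Matrix (Fin 2) (Fin 2) K).det⁻¹ • (S : Matrix (Fin 2) (Fin 2) K).adjugate := by
    rw [Matrix.coe_units_inv]
    refine Matrix.inv_eq_left_inv ?_
    rw [Matrix.smul_mul, Matrix.adjugate_mul, smul_smul, inv_mul_cancel₀ hdet0, one_smul]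
  have hinvint : ∀ i k, Valued.v (((S⁻¹ : GL (Fin 2) K) : Matrix (Fin 2) (Fin 2) K) i k) ≤ 1 := by
    intro i k
    rw [hinv, Matrix.smul_apply, smul_eq_mul, map_mul, map_inv₀, hdet, inv_one, one_mul, Matrix.adjugate_fin_two]
    fin_cases i <;> fin_cases k
    · simpa using hint 1 1
    · simpa using hint 0 1
    · simpa using hint 1 0
    · simpa using hint 0 0
  -- `S⁻¹ S′ − 1 = S⁻¹ (S′ − S)`
  have hSS : ((S⁻¹ : GL (Fin 2) K) : Matrix (Fin 2) (Fin 2) K) * (S : Matrix (Fin 2) (Fin 2) K) = 1 := Units.inv_mul S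
  have hfact : ((S⁻¹ * S' : GL (Fin 2) K) : Matrix (Fin 2) (Fin 2) K) - 1 =
      ((S⁻¹ : GL (Fin 2) K) : Matrix (Fin 2) (Fin 2) K) * (((S' : Matrix (Fin 2) (Fin 2) K) - 1) - ((S : Matrix (Fin 2) (Fin 2) K) - 1)) := by
    rw [sub_sub_sub_cancel_right, Matrix.mul_sub, hSS, Units.val_mul]
  intro i k
  rw [hfact, Matrix.mul_apply, Fin.sum_univ_two]
  have hdiff : ∀ l, Valued.v ((((S' : Matrix (Fin 2) (Fin 2) K) - 1) - ((S : Matrix (Fin 2) (Fin 2) K) - 1)) l k) ≤ r := fun l => by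
    rw [Matrix.sub_apply]
    exact Valued.v.map_sub_le (hS' l k) (hS l k)
  refine Valued.v.map_add_le ?_ ?_
  · rw [map_mul]; exact (mul_le_mul' (hinvint i 0) (hdiff 0)).trans_eq (one_mul r)
  · rw [map_mul]; exact (mul_le_mul' (hinvint i 1) (hdiff 1)).trans_eq (one_mul r)

/-- **THE `diag(1,α)`-TWIST COSTS AT MOST `|α|⁻¹`**: if `M ≡ 1` modulo valuation `≤ ρ` entrywise and `0 < |α| ≤ 1`, then `diag(1,α⁻¹)·M·diag(1,α) ≡ 1` modulo `≤ ρ·|α|⁻¹`.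
[cite: LabesseLanglands1979, §2 p. 8] -/
theorem forall_v_diagonal_twist_sub_one_le {α : K} (hα0 : α ≠ 0) (hα1 : Valued.v α ≤ 1) (M : Matrix (Fin 2) (Fin 2) K) {ρ : Γ₀}
    (h : ∀ i k, Valued.v ((M - 1) i k) ≤ ρ) :
    ∀ i k, Valued.v ((Matrix.diagonal ![1, α⁻¹] * M * Matrix.diagonal ![1, α] - 1) i k) ≤ ρ * (Valued.v α)⁻¹ := by
  have hvα0 : Valued.v α ≠ 0 := (Valuation.ne_zero_iff _).2 hα0
  have hvαpos : 0 < Valued.v α := zero_lt_iff.2 hvα0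
  have hinvge : 1 ≤ (Valued.v α)⁻¹ := one_le_inv₀ hvαpos |>.2 hα1
  have hone : (![(1 : K), α⁻¹] : Fin 2 → K) = ![(1 : K)⁻¹, α⁻¹] := by rw [inv_one]
  have hconj1 : Matrix.diagonal ![1, α⁻¹] * (1 : Matrix (Fin 2) (Fin 2) K) * Matrix.diagonal ![1, α] = 1 := by
    rw [Matrix.mul_one]
    exact Literature.NumberTheory.Automorphic.UnitaryGroup.diagonal_inv_mul_diagonal hα0
  have h0 : (![(1 : K)⁻¹, α⁻¹] : Fin 2 → K) 0 = 1 := by simp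
  have h1 : (![(1 : K)⁻¹, α⁻¹] : Fin 2 → K) 1 = α⁻¹ := by simp
  have h0' : (![(1 : K), α] : Fin 2 → K) 0 = 1 := by simp
  have h1' : (![(1 : K), α] : Fin 2 → K) 1 = α := by simp
  intro i k
  have hentry : (Matrix.diagonal ![1, α⁻¹] * M * Matrix.diagonal ![1, α] - 1) i k = (![(1 : K)⁻¹, α⁻¹] i) * (M - 1) i k * (![1, α] k) := by
    have hsub : Matrix.diagonal ![1, α⁻¹] * M * Matrix.diagonal ![1, α] - 1 = Matrix.diagonal ![1, α⁻¹] * (M - 1) * Matrix.diagonal ![1, α] := by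
      rw [Matrix.mul_sub, Matrix.sub_mul, hconj1]
    rw [hsub, hone]
    exact LocalFields.QuadraticRegularRep.diagonal_inv_mul_mul_diagonal_apply 1 α (M - 1) i k
  rw [hentry, map_mul, map_mul]
  fin_cases i <;> fin_cases k
  · rw [Fin.zero_eta, h0, h0', map_one, one_mul, mul_one]
    exact (h 0 0).trans (le_mul_of_one_le_right' hinvge)
  · rw [Fin.zero_eta, Fin.mk_one, h0, h1', map_one, one_mul]
    calc Valued.v ((M - 1) 0 1) * Valued.v α ≤ ρ * 1 := mul_le_mul' (h 0 1) hα1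
      _ ≤ ρ * (Valued.v α)⁻¹ := mul_le_mul_right hinvge ρ
  · rw [Fin.zero_eta, Fin.mk_one, h1, h0', map_one, mul_one, map_inv₀, mul_comm]
    exact mul_le_mul_left (h 1 0) _
  · rw [Fin.mk_one, h1, h1', map_inv₀, mul_assoc, mul_comm (Valued.v ((M - 1) 1 1)), ← mul_assoc, inv_mul_cancel₀ hvα0, one_mul]
    exact (h 1 1).trans (le_mul_of_one_le_right' hinvge)

end Estimates


/-! ## §4 Entrywise `exp(−j)`-balls shrink into every neighbourhood of `1` (matrices, then closed subgroups of `GL₂`) -/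

section NhdsGL

variable (L : Type) [Field L] [NumberField L] (w₁ : HeightOneSpectrum (𝓞 L))

/-- **ENTRYWISE BALLS ARE A NEIGHBOURHOOD BASIS AT `1` IN `M₂(L_w)`** (consequence form): every neighbourhood of `1` contains an entrywise `exp(−j)`-ball
(★ `exists_exp_lt_of_mem_nhds` entry by entry). [cite: NeukirchANT1999, Ch. II §5 (5.3)] -/
theorem exists_forall_matrix_mem_of_mem_nhds_one {u : Set (Matrix (Fin 2) (Fin 2) (w₁.adicCompletion L))}
    (hu : u ∈ 𝓝 (1 : Matrix (Fin 2) (Fin 2) (w₁.adicCompletion L))) :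
    ∃ j : ℕ, ∀ M : Matrix (Fin 2) (Fin 2) (w₁.adicCompletion L), (∀ i k, Valued.v ((M - 1) i k) ≤ WithZero.exp (-(j : ℤ))) → M ∈ u := by
  by_contra hcon
  push Not at hcon
  choose M hM hMu using hcon
  have ht : Tendsto M atTop (𝓝 (1 : Matrix (Fin 2) (Fin 2) (w₁.adicCompletion L))) := by
    refine tendsto_pi_nhds.2 fun i => tendsto_pi_nhds.2 fun k => ?_
    rw [tendsto_def]
    intro s hs
    obtain ⟨n, hn⟩ := exists_exp_lt_of_mem_nhds w₁ hs
    refine (eventually_gt_atTop n).mono fun j hj => hn _ ?_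
    have h := hM j i k
    rw [Matrix.sub_apply] at h
    exact lt_of_le_of_lt h (WithZero.exp_lt_exp.2 (by omega))
  obtain ⟨j, hj⟩ := (ht.eventually hu).exists
  exact hMu j hj

/-- **QUANTITATIVE NEIGHBOURHOODS OF `1` IN A SUBGROUP OF `GL₂(L_w)`**: for `V₁ ∈ 𝓝 1` in `↥Γ` there is a depth `j` such that every `g ∈ Γ` with `g ≡ 1` and
`g⁻¹ ≡ 1` entrywise modulo valuation `≤ exp(−j)` lies in `V₁` (units topology `g ↦ (g, g⁻¹)`, ★ Mathlib `Units.isInducing_embedProduct`). [cite: NeukirchANT1999, Ch. II §5 (5.3)] [cite: Serre1980Trees, Ch. II §1.2] -/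
theorem exists_depth_mem_of_mem_nhds_one (Γ : Subgroup (GL (Fin 2) (w₁.adicCompletion L))) {V₁ : Set ↥Γ} (hV₁ : V₁ ∈ 𝓝 (1 : ↥Γ)) :
    ∃ j : ℕ, ∀ g : ↥Γ, (∀ i k, Valued.v ((((g : GL (Fin 2) (w₁.adicCompletion L)) : Matrix (Fin 2) (Fin 2) (w₁.adicCompletion L)) - 1) i k) ≤ WithZero.exp (-(j : ℤ))) →
      (∀ i k, Valued.v (((((g⁻¹ : ↥Γ) : GL (Fin 2) (w₁.adicCompletion L)) : Matrix (Fin 2) (Fin 2) (w₁.adicCompletion L)) - 1) i k) ≤ WithZero.exp (-(j : ℤ))) →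
      g ∈ V₁ := by
  have hind : Topology.IsInducing (fun g : ↥Γ => Units.embedProduct (Matrix (Fin 2) (Fin 2) (w₁.adicCompletion L)) (g : GL (Fin 2) (w₁.adicCompletion L))) :=
    Units.isInducing_embedProduct.comp Topology.IsInducing.subtypeVal
  rw [hind.nhds_eq_comap, Filter.mem_comap] at hV₁
  obtain ⟨B, hB, hBV⟩ := hV₁
  have h1 : Units.embedProduct (Matrix (Fin 2) (Fin 2) (w₁.adicCompletion L)) ((1 : ↥Γ) : GL (Fin 2) (w₁.adicCompletion L)) =
      ((1 : Matrix (Fin 2) (Fin 2) (w₁.adicCompletion L)), MulOpposite.op 1) := by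
    rw [OneMemClass.coe_one, map_one, Prod.one_eq_mk, MulOpposite.op_one]
  rw [h1, mem_nhds_prod_iff] at hB
  obtain ⟨u, hu, u', hu', huu⟩ := hB
  have hu'' : MulOpposite.op ⁻¹' u' ∈ 𝓝 (1 : Matrix (Fin 2) (Fin 2) (w₁.adicCompletion L)) :=
    MulOpposite.continuous_op.continuousAt.preimage_mem_nhds (by rwa [MulOpposite.op_one] at hu')
  obtain ⟨j₁, hj₁⟩ := exists_forall_matrix_mem_of_mem_nhds_one L w₁ hu
  obtain ⟨j₂, hj₂⟩ := exists_forall_matrix_mem_of_mem_nhds_one L w₁ hu''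
  have hle₁ : WithZero.exp (-((max j₁ j₂ : ℕ) : ℤ)) ≤ WithZero.exp (-(j₁ : ℤ)) := WithZero.exp_le_exp.2 (by omega)
  have hle₂ : WithZero.exp (-((max j₁ j₂ : ℕ) : ℤ)) ≤ WithZero.exp (-(j₂ : ℤ)) := WithZero.exp_le_exp.2 (by omega)
  refine ⟨max j₁ j₂, fun g hg hg' => hBV ?_⟩
  show Units.embedProduct (Matrix (Fin 2) (Fin 2) (w₁.adicCompletion L)) (g : GL (Fin 2) (w₁.adicCompletion L)) ∈ B
  rw [Units.embedProduct_apply]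
  refine huu (Set.mk_mem_prod (hj₁ _ fun i k => (hg i k).trans hle₁) (hj₂ _ fun i k => ?_))
  have h := hg' i k
  rw [Subgroup.coe_inv] at h
  exact h.trans hle₂

end NhdsGL

end Literature.NumberTheory.Automorphic.UnitaryGroup

end
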